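import Mathlib

/-!
# Manin–Gamma cell (pub-manin-gamma0): `√p* ∈ ℚ(ζ_p)` via the quadratic Gauss sum (seat p1, gen 2) — field part of Lemma 4.4(i)

`proofs/AppA_descent_lead.md` §B(i): for an odd prime `p`, the Gauss sum `g = Σ_a (a/p) ζ_p^a` satisfies `g² = p* := (−1)^{(p−1)/2} p`,
so `ℚ(√p*) ⊆ ℚ(ζ_p)` — the quadratic subfield of the `p`-power cyclotomic fields used in T1_lead Prop. 4.6(i)
(«d_i(R_Q) ∈ {1, p*}»). This file machine-checks it with Mathlib's `gaussSum_sq`: in ANY field `K` of characteristic 0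
containing a primitive `p`-th root of unity `ζ`, the element `g := gaussSum χ ψ` (χ = quadratic character of `ZMod p` pushed to `K`,
ψ = a ↦ ζ^a) lies in `ℚ[ζ] = Algebra.adjoin ℚ {ζ}` and satisfies `g² = χ(−1)·p`, with `χ(−1) = 1` if `p ≡ 1 (mod 4)` and
`= −1` if `p ≡ 3 (mod 4)`.

* `ManinGamma.GaussSumSqrt.gaussSum_sq_eq`      — `g² = χ(−1)·p`.
* `ManinGamma.GaussSumSqrt.gaussSum_mem_adjoin`  — `g ∈ Algebra.adjoin ℚ {ζ}`.
* `ManinGamma.GaussSumSqrt.exists_sqrt_pstar_mem_adjoin` — `∃ g ∈ ℚ[ζ], g² = ± p` with the sign `χ₄(p)`.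
Only Mathlib is imported; no `sorry`.
-/

namespace ManinGamma.GaussSumSqrt

open AddChar MulChar

variable {K : Type*} [Field K] [CharZero K]

/-- `g² = χ(−1) · p` for the quadratic Gauss sum built from a primitive `p`-th root of unity `ζ ∈ K`, `p` an odd prime. -/
theorem gaussSum_sq_eq (p : ℕ) [Fact p.Prime] (hp : p ≠ 2) {ζ : K} (hζ : IsPrimitiveRoot ζ p) :
    (gaussSum ((quadraticChar (ZMod p)).ringHomComp (Int.castRingHom K)) (zmodChar p ((IsPrimitiveRoot.iff_def ζ p).mp hζ).left)) ^ 2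
      = ((quadraticChar (ZMod p)) (-1) : K) * (p : K) := by
  have hchar : ringChar (ZMod p) ≠ 2 := by
    rw [ZMod.ringChar_zmod_n]; exact hp
  have hχ₁ : (quadraticChar (ZMod p)).ringHomComp (Int.castRingHom K) ≠ 1 := by
    rw [ringHomComp_ne_one_iff (RingHom.injective_int (Int.castRingHom K))]
    exact quadraticChar_ne_one hchar
  have hχ₂ : ((quadraticChar (ZMod p)).ringHomComp (Int.castRingHom K)).IsQuadratic := (quadraticChar_isQuadratic (ZMod p)).comp _
  have hψ := zmodChar_primitive_of_primitive_root p hζ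
  have h := gaussSum_sq hχ₁ hχ₂ hψ
  rw [h, ZMod.card p]
  simp [ringHomComp]

/-- The Gauss sum lies in `ℚ[ζ] = Algebra.adjoin ℚ {ζ}`. -/
theorem gaussSum_mem_adjoin (p : ℕ) [Fact p.Prime] {ζ : K} (hζ : IsPrimitiveRoot ζ p) :
    gaussSum ((quadraticChar (ZMod p)).ringHomComp (Int.castRingHom K)) (zmodChar p ((IsPrimitiveRoot.iff_def ζ p).mp hζ).left) ∈ Algebra.adjoin ℚ {ζ} := by
  unfold gaussSum
  refine Subalgebra.sum_mem _ (fun a _ => Subalgebra.mul_mem _ ?_ ?_)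
  · -- χ a ∈ {0, ±1} ⊂ ℤ ⊂ ℚ[ζ]
    simp only [ringHomComp, MulChar.coe_mk, MonoidHom.coe_mk, OneHom.coe_mk, eq_intCast]
    exact Subalgebra.intCast_mem _ _
  · rw [zmodChar_apply]
    exact Subalgebra.pow_mem _ (Algebra.subset_adjoin (Set.mem_singleton ζ)) _

/-- **Lemma 4.4(i), field part.** For an odd prime `p` and a primitive `p`-th root of unity `ζ` in a field `K` of characteristic
`0`, there is `g ∈ ℚ[ζ]` with `g² = p` if `p ≡ 1 (mod 4)` and `g² = −p` if `p ≡ 3 (mod 4)`; i.e. `√p* ∈ ℚ(ζ_p)`. -/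
theorem exists_sqrt_pstar_mem_adjoin (p : ℕ) [Fact p.Prime] (hp : p ≠ 2) {ζ : K} (hζ : IsPrimitiveRoot ζ p) :
    ∃ g ∈ Algebra.adjoin ℚ {ζ}, g ^ 2 = (if p % 4 = 1 then (p : K) else -(p : K)) := by
  refine ⟨_, gaussSum_mem_adjoin p hζ, ?_⟩
  rw [gaussSum_sq_eq p hp hζ]
  have hchar : ringChar (ZMod p) ≠ 2 := by
    rw [ZMod.ringChar_zmod_n]; exact hp
  classical
  rw [quadraticChar_neg_one hchar, ZMod.card p]
  have hodd : p % 2 = 1 := Nat.odd_iff.mp ((Fact.out : p.Prime).odd_of_ne_two hp)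
  rw [ZMod.χ₄_nat_eq_if_mod_four, if_neg (by omega)]
  by_cases h1 : p % 4 = 1
  · simp [h1]
  · simp [h1]

end ManinGamma.GaussSumSqrt
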